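import Summits.BirchSwinnertonDyer.BirchSwinnertonDyer.Theorems.KimAtThreeDeepLowerKatoCiteOnlyNine
import HarnessLib

/-!
# The two BC3 stubs of crux 19679 (`stub_nonAdditive`, `stub_additiveDefect`) BY NAME from the crux, hence from
# the eight cite-only named facts of the skeleton of record `katoLit`
# (cell `bsd-addord`, seat w2-acc2 gen 9; route W2 `KimAtThreeKolyvagin`; `--supports stmt-BirchSwinnertonDyer-19679`, helper)

HONEST FRAMING.  Glue only (four theorems; no definition, no instance, no `sorry`; closes nothing; books nothing;
BSD is not proved by any of this).  The crux `DeepLowerAtThreeOffKatoStratum` (item 19679) was born with the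
planner's BC3 skeleton (bsd-addord-plan g16, `planner/splitW2L/bc/DeepLowerAtThreeOffKatoStratum_birth.lean`,
sha16 `e575d03075635394`): two stubs `stub_nonAdditive` (good or multiplicative reduction at `3`; ACCEL-LIST
row (2), seat w2-acc2) and `stub_additiveDefect` (additive reduction at `3` with `3 ∣ c₃` or `#E(ℚ₃)[3] ≠ 1` or
`3 ∣` the Manin constant of the optimal datum; row (3), seat w2-acc3) and the case split
`DeepLowerAtThreeOffKatoStratum_of`.  Since 2026-08-27T15:58Z the skeleton OF RECORD is the owner's line
`katoLit` (w2-c2 g10): the crux BY NAME is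
`KimAtThreeDeepLowerKatoCiteOnlyNine.deepLowerAtThreeOffKatoStratum_of_nineCites` (p544671) from EIGHT cite-only
named statements (the nine of the parent `DeepLowerAtThree` minus Carayol): the three route leaves
`SakamotoKolyvaginThree` [Sakamoto 2024 Thm. 4.4], `RankEqAnalyticRankLeOne` [Gross–Zagier–Kolyvagin],
`PoitouTateSelmerDuality` [Poitou–Tate] and the five Literature facts (P123)
`cupLogInjective_and_hasDualExp_of_isDeRham` [Kato LNM 1553 II Prop. 1.2.3], (DR)
`isDeRham_restrictedRationalTateRep` [ibid. Ex. 1.3.5], (S5a) `expStarCoord_eq_zero_iff_kummer` [BK90 Prop. 3.8 /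
Ex. 3.11], (S5b-tower) `exists_smul_range_expStarCoord_tower_iff_trace_log` [Kato II Thm. 1.4.1 + BK90 3.8],
`Kato2004.exists_eulerSystem_definedExpStar_values` [Kato 2004 (8.1.3), Prop. 8.12, §9.4, Thm. 9.7, Thm. 6.6 (1),
Ex. 13.3].

This file records, BY NAME and with the two stub signatures VERBATIM (birth skeleton), that BOTH BC3 stubs are
consequences of the crux itself — on a non-additive row, resp. on an additive-defect row, the crux's off-stratum
hypothesis `¬ (Addv ∧ 3 ∤ c₃ ∧ #E(ℚ₃)[3] = 1 ∧ 3 ∤ c_{D₀})` is automatic — and therefore of the eight cite-only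
statements (§2).  Conversely the two stubs give the crux (§3, the birth case split, kernel-checked).  So the BC3
split and the cite road have the SAME residual: the eight published statements; the ACCEL-LIST rows (2)/(3) carry no
content beyond them.  (Mathematical reason, for the route card: the lower deep inequality
`∂⁽⁰⁾(δ̃) − ∂⁽∞⁾_deep(δ̃) ≤ ord₃ #Ш[3^∞]` is Mazur–Rubin rigidity `∂⁽⁰⁾(κ) − ∂⁽∞⁾(κ) = length Sel_{𝓕_can*}` read
through the dictionary `δ̃_n = u·3^e·x_n`, in which the exponent `e` cancels; the Tamagawa numbers at `ℓ ≠ 3` sit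
inside `ord λ`, `κ^{Kato} = λ·κ^{prim}`, and cancel too — no Tamagawa-divisibility input is needed for the LOWER side.)

References: [Kim2025RefinedTNC] Thm. 1.1; [Sakamoto2024] Thm. 4.4; [MazurRubin2004] Thm. 5.2.12;
[Kato2004Asterisque] (8.1.3), Prop. 8.12, §9.4, Thm. 9.7, Thm. 6.6 (1), Ex. 13.3; [Kato1993LNM1553] II Prop. 1.2.3,
Ex. 1.3.5, Thm. 1.4.1; [BlochKato1990] §3 Prop. 3.8, Ex. 3.11.
-/

noncomputable section

-- the cell's Theorems namespace `Summit.BirchSwinnertonDyer.BirchSwinnertonDyer.…` repeats the summit name by design (D-0017)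
set_option linter.dupNamespace false

open scoped Classical

open Literature.NumberTheory.EllipticCurves Literature.NumberTheory.PAdicHodge
open Literature.NumberTheory.EllipticCurves.Kato2004
open Summit.BirchSwinnertonDyer.BirchSwinnertonDyer.Theses.KimAtThreeKolyvagin

namespace Summit.BirchSwinnertonDyer.BirchSwinnertonDyer.Theorems.KimAtThreeDeepLowerOffStratumStubsOfNineCites

/-! ## §1 The two BC3 stubs from the crux (pure logic: the off-stratum hypothesis is automatic on their rows) -/

/-- **BC3 `stub_nonAdditive` (signature VERBATIM, birth skeleton `e575d03075635394`) from the crux**: on a row with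
good or multiplicative reduction at `3` the Kato-stratum conjunction `Addv ∧ …` is false, so the crux applies.
[cite: Kim2025RefinedTNC, Thm. 1.1] -/
theorem stub_nonAdditive_of_deepLowerAtThreeOffKatoStratum (h : DeepLowerAtThreeOffKatoStratum) :
    ∀ (W₀ : WeierstrassCurve ℚ) [W₀.IsElliptic] [W₀.IsGloballyMinimal],
      (∀ n : ℕ, W₀.HasSurjectiveModNGaloisRep (3 ^ n : ℕ)) → Finite W₀.sha →
      ∀ {N : ℕ} [NeZero N], N = W₀.conductorNorm ℤ →
      ∀ (D₀ : Literature.NumberTheory.EllipticCurves.ModularForms.ModularParametrizationData W₀ N),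
        (∀ z ∈ D₀.L.lattice, ∃ w ∈ Literature.NumberTheory.EllipticCurves.ModularForms.periodLattice D₀.f, z = D₀.c * w) →
        (∀ (W₂ : WeierstrassCurve ℚ) [W₂.IsElliptic]
          (D₂ : Literature.NumberTheory.EllipticCurves.ModularForms.ModularParametrizationData W₂ N),
          D₂.f = D₀.f → D₀.modularDegree ≤ D₂.modularDegree) →
        (∀ r : ℚ, Literature.NumberTheory.EllipticCurves.ratPlusSymbol D₀.f r ≠ 0 →
          0 ≤ padicValRat 3 (Literature.NumberTheory.EllipticCurves.ratPlusSymbol D₀.f r)) →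
        Literature.NumberTheory.EllipticCurves.kuriharaVanishingOrder W₀ 3 D₀.f = 0 →
        ¬ (haveI : Fact (Nat.Prime 3) := ⟨Nat.prime_three⟩;
            Literature.NumberTheory.EllipticCurves.Rank1Residual.Addv W₀ 3) →
        ∃ d : ℕ, Literature.NumberTheory.EllipticCurves.kuriharaPartialDeepInfty W₀ 3 D₀.f = d ∧
          Literature.NumberTheory.EllipticCurves.kuriharaPartial W₀ 3 D₀.f 0 ≤
            ((padicValNat 3 (Nat.card (AddCommGroup.primaryComponent W₀.sha 3)) + d : ℕ) : ℕ∞) := by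
  intro W₀ _ _ htow hfin N _ hN D₀ hopt hdeg hint hord hA
  exact h W₀ htow hfin hN D₀ hopt hdeg hint hord fun hcon => hA hcon.1

/-- **BC3 `stub_additiveDefect` (signature VERBATIM, birth skeleton `e575d03075635394`) from the crux**: on an
additive row with `3 ∣ c₃` or `#E(ℚ₃)[3] ≠ 1` or `3 ∣ c_{D₀}` one conjunct of the Kato-stratum condition fails, so
the crux applies. [cite: Kim2025RefinedTNC, Thm. 1.1] -/
theorem stub_additiveDefect_of_deepLowerAtThreeOffKatoStratum (h : DeepLowerAtThreeOffKatoStratum) :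
    ∀ (W₀ : WeierstrassCurve ℚ) [W₀.IsElliptic] [W₀.IsGloballyMinimal],
      (∀ n : ℕ, W₀.HasSurjectiveModNGaloisRep (3 ^ n : ℕ)) → Finite W₀.sha →
      ∀ {N : ℕ} [NeZero N], N = W₀.conductorNorm ℤ →
      ∀ (D₀ : Literature.NumberTheory.EllipticCurves.ModularForms.ModularParametrizationData W₀ N),
        (∀ z ∈ D₀.L.lattice, ∃ w ∈ Literature.NumberTheory.EllipticCurves.ModularForms.periodLattice D₀.f, z = D₀.c * w) →
        (∀ (W₂ : WeierstrassCurve ℚ) [W₂.IsElliptic]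
          (D₂ : Literature.NumberTheory.EllipticCurves.ModularForms.ModularParametrizationData W₂ N),
          D₂.f = D₀.f → D₀.modularDegree ≤ D₂.modularDegree) →
        (∀ r : ℚ, Literature.NumberTheory.EllipticCurves.ratPlusSymbol D₀.f r ≠ 0 →
          0 ≤ padicValRat 3 (Literature.NumberTheory.EllipticCurves.ratPlusSymbol D₀.f r)) →
        Literature.NumberTheory.EllipticCurves.kuriharaVanishingOrder W₀ 3 D₀.f = 0 →
        (haveI : Fact (Nat.Prime 3) := ⟨Nat.prime_three⟩;
            Literature.NumberTheory.EllipticCurves.Rank1Residual.Addv W₀ 3) →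
        (3 ∣ (W₀.baseChange ℚ_[3]).localTamagawaNumber ℤ_[3] ∨
          Nat.card {Q : (W₀.baseChange ℚ_[3]).toAffine.Point // (3 : ℕ) • Q = 0} ≠ 1 ∨
          (3 : ℤ) ∣ D₀.maninConstant) →
        ∃ d : ℕ, Literature.NumberTheory.EllipticCurves.kuriharaPartialDeepInfty W₀ 3 D₀.f = d ∧
          Literature.NumberTheory.EllipticCurves.kuriharaPartial W₀ 3 D₀.f 0 ≤
            ((padicValNat 3 (Nat.card (AddCommGroup.primaryComponent W₀.sha 3)) + d : ℕ) : ℕ∞) := by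
  intro W₀ _ _ htow hfin N _ hN D₀ hopt hdeg hint hord _hA hdef
  refine h W₀ htow hfin hN D₀ hopt hdeg hint hord fun hcon => ?_
  rcases hdef with h3 | ht | hc
  · exact hcon.2.1 h3
  · exact ht hcon.2.2.1
  · exact hcon.2.2.2 hc

/-! ## §2 Both stubs BY NAME from the eight cite-only named facts of the skeleton of record (conditional results) -/

variable (hSak : SakamotoKolyvaginThree) (hGZK : RankEqAnalyticRankLeOne) (hPT : PoitouTateSelmerDuality)
include hSak hGZK hPT

/-- **ACCEL-LIST row (2): `stub_nonAdditive` BY NAME from the eight cite-only named facts** (via p544671's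
`deepLowerAtThreeOffKatoStratum_of_nineCites`).  Conditional; closes nothing.
[cite: Kato2004Asterisque, (8.1.3), Prop. 8.12, §9.4, Thm. 9.7, Thm. 6.6 (1), Ex. 13.3] [cite: Sakamoto2024, Thm. 4.4 (p. 926)]
[cite: Kato1993LNM1553, Ch. II Prop. 1.2.3, Ex. 1.3.5, Thm. 1.4.1] [cite: BlochKato1990, §3 Prop. 3.8 and Ex. 3.11] -/
theorem stub_nonAdditive_of_eightCites (hP : cupLogInjective_and_hasDualExp_of_isDeRham)
    (hDR : isDeRham_restrictedRationalTateRep) (hS : expStarCoord_eq_zero_iff_kummer)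
    (hT₂ : exists_smul_range_expStarCoord_tower_iff_trace_log)
    (hLit : exists_eulerSystem_definedExpStar_values) :
    ∀ (W₀ : WeierstrassCurve ℚ) [W₀.IsElliptic] [W₀.IsGloballyMinimal],
      (∀ n : ℕ, W₀.HasSurjectiveModNGaloisRep (3 ^ n : ℕ)) → Finite W₀.sha →
      ∀ {N : ℕ} [NeZero N], N = W₀.conductorNorm ℤ →
      ∀ (D₀ : Literature.NumberTheory.EllipticCurves.ModularForms.ModularParametrizationData W₀ N),
        (∀ z ∈ D₀.L.lattice, ∃ w ∈ Literature.NumberTheory.EllipticCurves.ModularForms.periodLattice D₀.f, z = D₀.c * w) →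
        (∀ (W₂ : WeierstrassCurve ℚ) [W₂.IsElliptic]
          (D₂ : Literature.NumberTheory.EllipticCurves.ModularForms.ModularParametrizationData W₂ N),
          D₂.f = D₀.f → D₀.modularDegree ≤ D₂.modularDegree) →
        (∀ r : ℚ, Literature.NumberTheory.EllipticCurves.ratPlusSymbol D₀.f r ≠ 0 →
          0 ≤ padicValRat 3 (Literature.NumberTheory.EllipticCurves.ratPlusSymbol D₀.f r)) →
        Literature.NumberTheory.EllipticCurves.kuriharaVanishingOrder W₀ 3 D₀.f = 0 →
        ¬ (haveI : Fact (Nat.Prime 3) := ⟨Nat.prime_three⟩;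
            Literature.NumberTheory.EllipticCurves.Rank1Residual.Addv W₀ 3) →
        ∃ d : ℕ, Literature.NumberTheory.EllipticCurves.kuriharaPartialDeepInfty W₀ 3 D₀.f = d ∧
          Literature.NumberTheory.EllipticCurves.kuriharaPartial W₀ 3 D₀.f 0 ≤
            ((padicValNat 3 (Nat.card (AddCommGroup.primaryComponent W₀.sha 3)) + d : ℕ) : ℕ∞) :=
  stub_nonAdditive_of_deepLowerAtThreeOffKatoStratum
    (KimAtThreeDeepLowerKatoCiteOnlyNine.deepLowerAtThreeOffKatoStratum_of_nineCites hSak hGZK hPT hP hDR hS hT₂ hLit)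

/-- **ACCEL-LIST row (3): `stub_additiveDefect` BY NAME from the eight cite-only named facts** (via p544671).
Conditional; closes nothing.
[cite: Kato2004Asterisque, (8.1.3), Prop. 8.12, §9.4, Thm. 9.7, Thm. 6.6 (1), Ex. 13.3] [cite: Sakamoto2024, Thm. 4.4 (p. 926)]
[cite: Kato1993LNM1553, Ch. II Prop. 1.2.3, Ex. 1.3.5, Thm. 1.4.1] [cite: BlochKato1990, §3 Prop. 3.8 and Ex. 3.11] -/
theorem stub_additiveDefect_of_eightCites (hP : cupLogInjective_and_hasDualExp_of_isDeRham)
    (hDR : isDeRham_restrictedRationalTateRep) (hS : expStarCoord_eq_zero_iff_kummer)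
    (hT₂ : exists_smul_range_expStarCoord_tower_iff_trace_log)
    (hLit : exists_eulerSystem_definedExpStar_values) :
    ∀ (W₀ : WeierstrassCurve ℚ) [W₀.IsElliptic] [W₀.IsGloballyMinimal],
      (∀ n : ℕ, W₀.HasSurjectiveModNGaloisRep (3 ^ n : ℕ)) → Finite W₀.sha →
      ∀ {N : ℕ} [NeZero N], N = W₀.conductorNorm ℤ →
      ∀ (D₀ : Literature.NumberTheory.EllipticCurves.ModularForms.ModularParametrizationData W₀ N),
        (∀ z ∈ D₀.L.lattice, ∃ w ∈ Literature.NumberTheory.EllipticCurves.ModularForms.periodLattice D₀.f, z = D₀.c * w) →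
        (∀ (W₂ : WeierstrassCurve ℚ) [W₂.IsElliptic]
          (D₂ : Literature.NumberTheory.EllipticCurves.ModularForms.ModularParametrizationData W₂ N),
          D₂.f = D₀.f → D₀.modularDegree ≤ D₂.modularDegree) →
        (∀ r : ℚ, Literature.NumberTheory.EllipticCurves.ratPlusSymbol D₀.f r ≠ 0 →
          0 ≤ padicValRat 3 (Literature.NumberTheory.EllipticCurves.ratPlusSymbol D₀.f r)) →
        Literature.NumberTheory.EllipticCurves.kuriharaVanishingOrder W₀ 3 D₀.f = 0 →
        (haveI : Fact (Nat.Prime 3) := ⟨Nat.prime_three⟩;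
            Literature.NumberTheory.EllipticCurves.Rank1Residual.Addv W₀ 3) →
        (3 ∣ (W₀.baseChange ℚ_[3]).localTamagawaNumber ℤ_[3] ∨
          Nat.card {Q : (W₀.baseChange ℚ_[3]).toAffine.Point // (3 : ℕ) • Q = 0} ≠ 1 ∨
          (3 : ℤ) ∣ D₀.maninConstant) →
        ∃ d : ℕ, Literature.NumberTheory.EllipticCurves.kuriharaPartialDeepInfty W₀ 3 D₀.f = d ∧
          Literature.NumberTheory.EllipticCurves.kuriharaPartial W₀ 3 D₀.f 0 ≤
            ((padicValNat 3 (Nat.card (AddCommGroup.primaryComponent W₀.sha 3)) + d : ℕ) : ℕ∞) :=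
  stub_additiveDefect_of_deepLowerAtThreeOffKatoStratum
    (KimAtThreeDeepLowerKatoCiteOnlyNine.deepLowerAtThreeOffKatoStratum_of_nineCites hSak hGZK hPT hP hDR hS hT₂ hLit)

omit hSak hGZK hPT

/-! ## §3 Conversely: the two stubs give the crux (the birth case split, kernel-checked; the tree had it only as a
planner draft) — so «BC3 stubs» and «crux» are EQUIVALENT by name -/

/-- **The crux from the two BC3 stubs** (birth composition `DeepLowerAtThreeOffKatoStratum_of`, VERBATIM): case split
on `Addv W₀ 3`; on the additive branch the off-stratum hypothesis yields the defect disjunction.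
[cite: Kim2025RefinedTNC, Thm. 1.1] -/
theorem deepLowerAtThreeOffKatoStratum_of_stubs
    (h₁ : ∀ (W₀ : WeierstrassCurve ℚ) [W₀.IsElliptic] [W₀.IsGloballyMinimal],
      (∀ n : ℕ, W₀.HasSurjectiveModNGaloisRep (3 ^ n : ℕ)) → Finite W₀.sha →
      ∀ {N : ℕ} [NeZero N], N = W₀.conductorNorm ℤ →
      ∀ (D₀ : Literature.NumberTheory.EllipticCurves.ModularForms.ModularParametrizationData W₀ N),
        (∀ z ∈ D₀.L.lattice, ∃ w ∈ Literature.NumberTheory.EllipticCurves.ModularForms.periodLattice D₀.f, z = D₀.c * w) →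
        (∀ (W₂ : WeierstrassCurve ℚ) [W₂.IsElliptic]
          (D₂ : Literature.NumberTheory.EllipticCurves.ModularForms.ModularParametrizationData W₂ N),
          D₂.f = D₀.f → D₀.modularDegree ≤ D₂.modularDegree) →
        (∀ r : ℚ, Literature.NumberTheory.EllipticCurves.ratPlusSymbol D₀.f r ≠ 0 →
          0 ≤ padicValRat 3 (Literature.NumberTheory.EllipticCurves.ratPlusSymbol D₀.f r)) →
        Literature.NumberTheory.EllipticCurves.kuriharaVanishingOrder W₀ 3 D₀.f = 0 →
        ¬ (haveI : Fact (Nat.Prime 3) := ⟨Nat.prime_three⟩;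
            Literature.NumberTheory.EllipticCurves.Rank1Residual.Addv W₀ 3) →
        ∃ d : ℕ, Literature.NumberTheory.EllipticCurves.kuriharaPartialDeepInfty W₀ 3 D₀.f = d ∧
          Literature.NumberTheory.EllipticCurves.kuriharaPartial W₀ 3 D₀.f 0 ≤
            ((padicValNat 3 (Nat.card (AddCommGroup.primaryComponent W₀.sha 3)) + d : ℕ) : ℕ∞))
    (h₂ : ∀ (W₀ : WeierstrassCurve ℚ) [W₀.IsElliptic] [W₀.IsGloballyMinimal],
      (∀ n : ℕ, W₀.HasSurjectiveModNGaloisRep (3 ^ n : ℕ)) → Finite W₀.sha →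
      ∀ {N : ℕ} [NeZero N], N = W₀.conductorNorm ℤ →
      ∀ (D₀ : Literature.NumberTheory.EllipticCurves.ModularForms.ModularParametrizationData W₀ N),
        (∀ z ∈ D₀.L.lattice, ∃ w ∈ Literature.NumberTheory.EllipticCurves.ModularForms.periodLattice D₀.f, z = D₀.c * w) →
        (∀ (W₂ : WeierstrassCurve ℚ) [W₂.IsElliptic]
          (D₂ : Literature.NumberTheory.EllipticCurves.ModularForms.ModularParametrizationData W₂ N),
          D₂.f = D₀.f → D₀.modularDegree ≤ D₂.modularDegree) →
        (∀ r : ℚ, Literature.NumberTheory.EllipticCurves.ratPlusSymbol D₀.f r ≠ 0 →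
          0 ≤ padicValRat 3 (Literature.NumberTheory.EllipticCurves.ratPlusSymbol D₀.f r)) →
        Literature.NumberTheory.EllipticCurves.kuriharaVanishingOrder W₀ 3 D₀.f = 0 →
        (haveI : Fact (Nat.Prime 3) := ⟨Nat.prime_three⟩;
            Literature.NumberTheory.EllipticCurves.Rank1Residual.Addv W₀ 3) →
        (3 ∣ (W₀.baseChange ℚ_[3]).localTamagawaNumber ℤ_[3] ∨
          Nat.card {Q : (W₀.baseChange ℚ_[3]).toAffine.Point // (3 : ℕ) • Q = 0} ≠ 1 ∨
          (3 : ℤ) ∣ D₀.maninConstant) →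
        ∃ d : ℕ, Literature.NumberTheory.EllipticCurves.kuriharaPartialDeepInfty W₀ 3 D₀.f = d ∧
          Literature.NumberTheory.EllipticCurves.kuriharaPartial W₀ 3 D₀.f 0 ≤
            ((padicValNat 3 (Nat.card (AddCommGroup.primaryComponent W₀.sha 3)) + d : ℕ) : ℕ∞)) :
    DeepLowerAtThreeOffKatoStratum := by
  intro W₀ _ _ htow hfin N _ hN D₀ hopt hdeg hint hord hoff
  by_cases hA : (haveI : Fact (Nat.Prime 3) := ⟨Nat.prime_three⟩;
      Literature.NumberTheory.EllipticCurves.Rank1Residual.Addv W₀ 3)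
  · refine h₂ W₀ htow hfin hN D₀ hopt hdeg hint hord hA ?_
    by_contra hcon
    exact hoff ⟨hA, fun h3 => hcon (Or.inl h3), Classical.not_not.mp fun ht => hcon (Or.inr (Or.inl ht)),
      fun hc => hcon (Or.inr (Or.inr hc))⟩
  · exact h₁ W₀ htow hfin hN D₀ hopt hdeg hint hord hA

end Summit.BirchSwinnertonDyer.BirchSwinnertonDyer.Theorems.KimAtThreeDeepLowerOffStratumStubsOfNineCites

end
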